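import Summits.QuantumFields.YangMills.Theorems.OnsetSkewLawRPOnsetFloorPositiveTimeSynthesis
import Summits.QuantumFields.YangMills.Theorems.OnsetSkewLawRPOnsetFloorCrossFloorDatum
import HarnessLib

/-!
# The stub `stub_positiveTimeSynthesisCollar : StubPosTimeSynthCollarP` BY NAME (LINES «FloorInheritance» v5 on crux 23138 /
# «MarkovFloorInheritance» v3 on crux 22956, planner ym-idea-11 g13) and its consumer-side corollaries

The mathematics is `RPOnsetFloorPosTimeSynth.posTimeSynthC_of_slotSynth` (`OnsetSkewLawRPOnsetFloorPositiveTimeSynthesis.lean`: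
Whitney-type partition of the open half-space × single-slot synthesis per piece).  This file records the registered texts
VERBATIM (`E4` spelled out; `SlotSynth`, `StubSingleSlotP`, `StubPosTimeSynthCollarP` are registered-stub copies, not citable
facts — the pattern of `OnsetSkewLawRPOnsetFloorCellShift.lean`; `PosTimeSynthC`, `AdmBump`, `OnsetFloorQ2`, `CrossFloorDatum` are
the tree copies in `RPOnsetFloorCoarseCollar` / `RPOnsetFloorCellShift`) and proves

* `stub_positiveTimeSynthesisCollar : StubPosTimeSynthCollarP` — the stub BY NAME;
* `collarSynthesis_of_singleSlot : StubSingleSlotP → ∀ b R₀ t, AdmBump b R₀ t → ∃ C N, 0 ≤ C ∧ PosTimeSynthC b C N` — hypothesis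
  (H1) of the tree's `RPOnsetFloorCoarseCollar.CrossFloorAtomsP` from single-slot synthesis alone (`StubSingleSlotP` is the
  registered `stub_singleSlot` of the crux AtomicSynthesis, stmt-QuantumFields-28126);
* `crossFloorDatum_of_singleSlot` — THE CHAIN for the record: `stub_singleSlot` + the two-point floor residual `OnsetFloorQ2`
  give `CrossFloorDatum G` for every `SU(2)`-class `G` (tree `crossFloorAtoms`), hence a coarse collar atom carrying the floor
  (tree `coarseAtomFloor_of_crossFloorDatum`): the head of the g13 lines is reduced to `stub_singleSlot` + `OnsetFloorQ2`.

Compatibility: with this file imported, the skeleton's `theorem stub_positiveTimeSynthesisCollar : StubPosTimeSynthCollarP :=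
Summit.QuantumFields.YangMills.Theorems.RPOnsetFloorPosTimeSynthCollar.stub_positiveTimeSynthesisCollar` elaborates (same texts
modulo the `E4` abbreviation).  REGISTRY NOTE (honest): registered on 23138 (v5 sha 09e801d0) / 22956 (v3) when taken
(2026-08-29T05:29Z); both registries were re-pointed to the «FemtoWitness» lines at 05:31Z, so this lands as a HELPER.
HONEST FRAMING: analysis plumbing; `stub_singleSlot` (L), the residual `OnsetFloorQ2`, the cruxes 23138 / 22956 / 28126, every
rung and the summit are untouched; the Yang–Mills mass gap is NOT proved.  Cell `ym-idea-1`, width seat `ym-line-sfw-p2-w4` g21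
(free hands). [folklore]
-/

set_option autoImplicit false

noncomputable section

namespace Summit.QuantumFields.YangMills.Theorems.RPOnsetFloorPosTimeSynthCollar

open Literature.MathematicalPhysics.QuantumFieldTheory Literature.MathematicalPhysics.QuantumLattice
open Summit.QuantumFields.YangMills.Theorems.RPOnsetFloorCellShift (AdmBump)
open Summit.QuantumFields.YangMills.Theorems.RPOnsetFloorCoarseCollar (PosTimeSynthC OnsetFloorQ2 CrossFloorDatum
  crossFloorAtoms)
open Summit.QuantumFields.YangMills.Theorems.RPOnsetFloorPosTimeSynth (posTimeSynthC_of_slotSynth)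

/-! ## §1 Registered texts (verbatim from the skeletons, `E4` spelled out; registered-stub copies, not citable facts) -/

/-- Single-slot fixed-father-bump synthesis with constants `C₁, N₁` (verbatim the skeletons' `SlotSynth`: LINE «SlotwiseSynthesis»
on AtomicSynthesis 28126, LINES «FloorInheritance» v5 / «MarkovFloorInheritance» v3): every Schwartz `ψ` on `ℝ⁴` supported in
`B̄(c, 3ρ/2)` with `ρ^m ‖D^m ψ‖ ≤ M'` (`m ≤ N₁`) is an `ℓ¹` series of `b`-atoms of scales `≤ ρ` centred within `2ρ` of `c`,
mass `≤ C₁ M'`. -/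
abbrev SlotSynth (b : SchwartzMap (EuclideanSpace ℝ (Fin 4)) ℝ) (C₁ : ℝ) (N₁ : ℕ) : Prop :=
  ∀ (ψ : SchwartzMap (EuclideanSpace ℝ (Fin 4)) ℝ) (c : EuclideanSpace ℝ (Fin 4)) (ρ M' : ℝ), 0 < ρ →
    tsupport ψ ⊆ Metric.closedBall c (3 / 2 * ρ) →
    (∀ m : ℕ, m ≤ N₁ → ∀ z, ‖iteratedFDeriv ℝ m ψ z‖ ≤ M' / ρ ^ m) →
    ∃ (a : ℕ → ℝ) (σ : ℕ → ℝ) (η : ℕ → EuclideanSpace ℝ (Fin 4)),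
      Summable (fun i => |a i|) ∧ ∑' i, |a i| ≤ C₁ * M' ∧
      (∀ i, 0 < σ i ∧ σ i ≤ ρ ∧ ‖η i - c‖ ≤ 2 * ρ) ∧
      ∀ z, ψ z = ∑' i, a i * b ((σ i)⁻¹ • (z - η i))

/-- The registered stub text `StubSingleSlotP` (verbatim; = `stub_singleSlot` of AtomicSynthesis 28126 and of the g13 lines):
single-slot synthesis holds for every compactly supported Schwartz father bump with non-zero integral. -/
abbrev StubSingleSlotP : Prop :=
  ∀ (b : SchwartzMap (EuclideanSpace ℝ (Fin 4)) ℝ), HasCompactSupport b → (∫ y, b y) ≠ 0 →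
    ∃ (C₁ : ℝ) (N₁ : ℕ), 0 ≤ C₁ ∧ SlotSynth b C₁ N₁

/-- The registered stub text `StubPosTimeSynthCollarP` (verbatim, `PosTimeSynthC` = the tree copy in
`RPOnsetFloorCoarseCollar`): single-slot synthesis for a positive-time compactly supported father bump gives the collar synthesis
(same derivative order `N₁`). -/
abbrev StubPosTimeSynthCollarP : Prop :=
  ∀ (b : SchwartzMap (EuclideanSpace ℝ (Fin 4)) ℝ), HasCompactSupport b →
    tsupport b ⊆ {u : EuclideanSpace ℝ (Fin 4) | 0 < u 0} →
    ∀ (C₁ : ℝ) (N₁ : ℕ), 0 ≤ C₁ → SlotSynth b C₁ N₁ → ∃ C : ℝ, 0 ≤ C ∧ PosTimeSynthC b C N₁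

/-! ## §2 The stub, BY NAME, and its consumer-side corollaries -/

/-- **`stub_positiveTimeSynthesisCollar` of LINES «FloorInheritance» v5 (23138) / «MarkovFloorInheritance» v3 (22956), BY NAME**
(Whitney-type partition of the open half-space × single-slot synthesis per piece; the mathematics is
`RPOnsetFloorPosTimeSynth.posTimeSynthC_of_slotSynth`). [folklore] -/
theorem stub_positiveTimeSynthesisCollar : StubPosTimeSynthCollarP :=
  fun b hb hb0 C₁ N₁ hC₁ hS => posTimeSynthC_of_slotSynth b hb hb0 C₁ N₁ hC₁ hS

/-- Hypothesis (H1) of the tree's `RPOnsetFloorCoarseCollar.CrossFloorAtomsP` — collar synthesis for every ADMISSIBLE collar bump —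
follows from single-slot synthesis alone (`StubSingleSlotP`, the registered `stub_singleSlot` of AtomicSynthesis 28126): an
admissible bump is compactly supported in `{u₀ > 0}` with `∫ b ≠ 0`. [folklore] -/
theorem collarSynthesis_of_singleSlot (hS : StubSingleSlotP) :
    ∀ (b : SchwartzMap (EuclideanSpace ℝ (Fin 4)) ℝ) (R₀ t : ℝ), AdmBump b R₀ t →
      ∃ (C : ℝ) (N : ℕ), 0 ≤ C ∧ PosTimeSynthC b C N := by
  intro b R₀ t hb
  obtain ⟨hcs, -, hpos, hint, -, -⟩ := hb
  obtain ⟨C₁, N₁, hC₁, hslot⟩ := hS b hcs hint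
  obtain ⟨C, hC, h⟩ := stub_positiveTimeSynthesisCollar b hcs hpos C₁ N₁ hC₁ hslot
  exact ⟨C, N₁, hC, h⟩

/-- THE CHAIN for the record: single-slot synthesis (`stub_singleSlot` of 28126) and the two-point floor residual `OnsetFloorQ2`
give the cross-floor datum `CrossFloorDatum G` for every `SU(2)`-class `G` (tree `RPOnsetFloorCoarseCollar.crossFloorAtoms`), hence
a coarse collar atom carrying the floor (tree `coarseAtomFloor_of_crossFloorDatum`) — i.e. the head of the g13 lines
«FloorInheritance» / «MarkovFloorInheritance» is reduced to `stub_singleSlot` + `OnsetFloorQ2`. [folklore] -/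
theorem crossFloorDatum_of_singleSlot (hS : StubSingleSlotP) (hQ : OnsetFloorQ2)
    (G : Type) [Group G] [TopologicalSpace G] [IsTopologicalGroup G] [CompactSpace G]
    (hG : IsCompactSimpleLieGroup G) (hSU : Nonempty (G ≃ₜ* Matrix.specialUnitaryGroup (Fin 2) ℂ)) :
    letI : MeasurableSpace G := borel G
    haveI : BorelSpace G := ⟨rfl⟩
    CrossFloorDatum G :=
  crossFloorAtoms (collarSynthesis_of_singleSlot hS) hQ G hG hSU

end Summit.QuantumFields.YangMills.Theorems.RPOnsetFloorPosTimeSynthCollar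

end
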